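import Summits.ResolutionOfSingularities.ResolutionOfSingularities.Theorems.SharpStrataSepExcModelsKolchinDimLeTwo
import HarnessLib

/-!
# Crux `SharpStrata.SepExcModels` (stmt-16828): the Kolchin phase in dimension 3 is governed by
# question (Q) — if normal 3-folds have no sharp point, it terminates

Line `birth`, lead c1, cycle 2, tool stub T8 `stub_acc_kolchinRel_of_noSharpNormal`. Lead 0 reduced
termination of the canonical Kolchin phase in dimension 3 to the sub-question (Q) of
`Cruxes/SepExcModels/prank1-analysis.md`: does a normal 3-fold over a perfect field have sharp points
at all (they would be generic points of curves with residue field of p-rank 1)? This file records,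
kernel-checked, the formal half of that reduction, uniformly in the dimension bound `d`:

* `normal_and_dim_le_of_kolchinRel` — a Kolchin successor of a variety of dimension `≤ d` has
  integrally closed local rings and dimension `≤ d` (it is the normalisation of a blow-up along a
  non-zero ideal; same proof as lead 0's `normal_and_dim_le_two_of_kolchinRel`, any `d`).
* `stub_acc_kolchinRel_of_noSharpNormal` — **if every `KVariety` with integrally closed local rings
  and dimension `≤ d` has empty sharp locus, then every `KVariety` of dimension `≤ d` is accessible
  for `KolchinRel k`** (depth ≤ 2: a successor is normal of dimension `≤ d`, hence has no sharp
  point, hence no successor). For `d = 2` the hypothesis is lead 0's theorem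
  `sharpLocus_eq_empty_of_normal_of_dim_le_two` (so `d = 2` recovers lead 0's `acc_kolchinRel_of_topologicalKrullDim_le_two`); for
  `d = 3` it is exactly a NEGATIVE answer to (Q). The lead's memo
  `Cruxes/SepExcModels/bluntness-certificates.md` §3–§5 explains why (Q) is more likely POSITIVE
  (sharp p-rank-1 points should exist: genus ≥ 2 exceptional curves over `K^{1/p}` with non-zero
  lifting obstruction), in which case this theorem is not the road to dimension 3 and the horizontal
  / vertical analysis of the memo takes over.
-/

noncomputable section

-- single-problem summit: the doubled namespace component `ResolutionOfSingularities` is forced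
set_option linter.dupNamespace false

open CategoryTheory AlgebraicGeometry TopologicalSpace Topology
open Literature.AlgebraicGeometry.Resolution

namespace Summit.ResolutionOfSingularities.ResolutionOfSingularities.Theorems.SepExcModels.KolchinNoSharp

/-- A Kolchin successor of a variety of dimension `≤ d` has integrally closed local rings and
dimension `≤ d`: it is isomorphic to the normalisation of a blow-up along the (non-zero) ideal of
the sharp centre, and proper birational alterations preserve the dimension. (Lead 0's
`normal_and_dim_le_two_of_kolchinRel`, verbatim for any bound.) [folklore] -/
theorem normal_and_dim_le_of_kolchinRel (k : Type) [Field k] {d : WithBot ℕ∞} {V' V : KVariety k}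
    (h : KolchinRel k V' V) (hV : topologicalKrullDim V.X ≤ d) :
    (∀ y : V'.X, IsIntegrallyClosed (V'.X.presheaf.stalk y)) ∧ topologicalKrullDim V'.X ≤ d := by
  obtain ⟨-, π, -, hS, B, β, hB, e, hblow, -⟩ := h
  haveI := hB
  haveI : IsLocallyNoetherian V.X := LocallyOfFiniteType.isLocallyNoetherian V.hom
  have hJ : Scheme.IdealSheafData.vanishingIdeal ⟨sharpCentre V.X, hS⟩ ≠ ⊥ :=
    NormalizedBlowup.vanishingIdeal_ne_bot ⟨sharpCentre V.X, hS⟩ (sharpCentre_ne_univ V.X)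
  haveI : IsProper β := hblow.isProper
  constructor
  · intro y
    exact IsIntegrallyClosed.of_equiv
      (asIso (e.hom.stalkMap y)).commRingCatIsoToRingEquiv
      (h := isIntegrallyClosed_stalk_normalization B (e.hom y))
  · have h1 : topologicalKrullDim V'.X = topologicalKrullDim (normalization B) :=
      IsHomeomorph.topologicalKrullDim_eq _ (Scheme.homeoOfIso e).isHomeomorph
    have h2 : topologicalKrullDim (normalization B) = topologicalKrullDim B :=
      (isAlteration_normalizationι B NoetherFiniteIntegralClosure_holds (β ≫ V.hom))
        |>.topologicalKrullDim_eq (β ≫ V.hom)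
    have h3 : topologicalKrullDim B = topologicalKrullDim V.X :=
      (isAlteration_of_isBlowup hblow hJ).topologicalKrullDim_eq V.hom
    rw [h1, h2, h3]
    exact hV

/-- **If normal varieties of dimension `≤ d` have no sharp point, the Kolchin phase terminates in
dimension `≤ d`** (registered tool stub T8 of line `birth`; for `d = 3` the hypothesis is a negative
answer to question (Q) of `prank1-analysis.md`): a successor `V'` of `V` is normal of dimension
`≤ d` (`normal_and_dim_le_of_kolchinRel`), so `sharpLocus V'.X = ∅` by hypothesis and `V'` has no
successor; accessibility with depth ≤ 2. Over ANY field. [cite: BenitoPiltantReguera2022, Question 6.6] -/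
theorem stub_acc_kolchinRel_of_noSharpNormal (k : Type) [Field k] (d : WithBot ℕ∞)
    (hQ : ∀ W : KVariety k, (∀ y : W.X, IsIntegrallyClosed (W.X.presheaf.stalk y)) →
      topologicalKrullDim W.X ≤ d → sharpLocus W.X = ∅)
    (V : KVariety k) (hV : topologicalKrullDim V.X ≤ d) : Acc (KolchinRel k) V := by
  refine Acc.intro V fun V' hV' => ?_
  obtain ⟨hN, hdim⟩ := normal_and_dim_le_of_kolchinRel k hV' hV
  refine Acc.intro V' fun V'' hV'' => ?_
  obtain ⟨hne, -⟩ := hV''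
  rw [hQ V' hN hdim] at hne
  exact absurd hne Set.not_nonempty_empty

end Summit.ResolutionOfSingularities.ResolutionOfSingularities.Theorems.SepExcModels.KolchinNoSharp

end
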